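import Summits.BirchSwinnertonDyer.Rank1Residual.Iwasawa.NoFiniteSubmoduleOfSelfDualLayers
import Literature.NumberTheory.EllipticCurves.IwasawaEulerCharDualityProofs
import HarnessLib

/-!
# The Hachimori–Matsuno criterion with PRINT-SHAPED pairing hypotheses: a non-degenerate pairing on
# the FINITE quotient `L_n/D_n` represents every character (counting `#Hom(C, ℚ/ℤ) = #C`)
# (pure algebra; cell `bsd-potss`, seat `bsd-potss-k8q-c5` g3; sequel of
# `NoFiniteSubmoduleOfSelfDualLayers`; K8-Gss2 node (R2±), items stmt-BirchSwinnertonDyer-19117 /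
# 19222 / 19233)

HONEST FRAMING (cell `bsd-potss`, run/shared/lean/pub/bsd-potss/): THEOREMS ONLY — elementary group
theory (quotients, Pontryagin duality for FINITE abelian groups via the tree's
`PontryaginCard.natCard_characterModule_of_finite`). NO elliptic-curve input, NO named fact, NO
definition; nothing asserted about any Selmer group; BSD is not proved by any of this.

PURPOSE. `Iwasawa.forall_finite_eq_bot_of_selfDualLayers` displays, for each layer, "every character
of `L_n` killing `D_n` is `⟨·, c⟩_n`" (`hsurj`). In print (Hachimori–Matsuno 2000: "a non-degenerate
skew-symmetric Galois-equivariant pairing `C_n × C_n → ℚ_p/ℤ_p`" on the FINITE group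
`C_n = Sel(E/K_n)/div`, Cassels–Tate / Milne ADT I §6; for Kobayashi's `Sel^±`: B. D. Kim 2007 / Flach)
one is given instead: `C_n = L_n/D_n` finite and the pairing non-degenerate. THIS FILE derives `hsurj`
from that shape — `exists_eq_pair_of_finite_quotient`: if `L/D` is finite, `D` lies in the left
kernel and contains the right kernel, then every character of `L` vanishing on `D` is
`⟨·, c⟩` (the map `L/D → Hom(L/D, ℚ/ℤ)` is injective between finite sets of the same cardinality) —
and restates the criterion with these hypotheses (`forall_finite_eq_bot_of_selfDualLayers_of_finite`).

References: [HachimoriMatsuno2000] Y. Hachimori, K. Matsuno, Proc. Amer. Math. Soc. 128 (2000)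
2539–2541 (proof of the Theorem); [Milne ADT] J. S. Milne, Arithmetic Duality Theorems, I §6
(Cassels–Tate pairing); [Washington1997] Prop. 13.28.
-/

set_option autoImplicit false

noncomputable section

open scoped Classical

open Literature.NumberTheory.EllipticCurves Literature.NumberTheory.EllipticCurves.IwasawaAlgebra
  Literature.NumberTheory.EllipticCurves.IwasawaDual

namespace Summit.BirchSwinnertonDyer.Rank1Residual.Iwasawa

/-! ## §1 Characters of a finite quotient are represented by a non-degenerate pairing -/

/-- **Representability from finiteness + non-degeneracy.** Let `⟨·,·⟩ : L × L → ℚ/ℤ` be biadditive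
with `D` contained in its left kernel and containing its right kernel, and `L/D` finite.
Then every character `g` of `L` vanishing on `D` is `g = ⟨·, c⟩` for some `c ∈ L`: `t ↦ ⟨·, t⟩`
descends to an injection `L/D ↪ Hom(L/D, ℚ/ℤ)` of finite sets of equal cardinality
(`PontryaginCard.natCard_characterModule_of_finite`), hence a bijection.
[cite: HachimoriMatsuno2000, Theorem (proof: "non-degenerate … pairing C_n × C_n → ℚ_p/ℤ_p", p. 2540)] -/
theorem exists_eq_pair_of_finite_quotient {L : Type*} [AddCommGroup L] (D : AddSubgroup L)
    (pair : L →+ L →+ AddCircle (1 : ℚ)) [Finite (L ⧸ D)]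
    (hker : ∀ t : L, (∀ y : L, pair y t = 0) → t ∈ D) (hDL : ∀ d ∈ D, ∀ t : L, pair d t = 0)
    (g : L →+ AddCircle (1 : ℚ)) (hg : ∀ d ∈ D, g d = 0) :
    ∃ c : L, ∀ y : L, g y = pair y c := by
  -- the character of `L ⧸ D` defined by `t`
  have hkt : ∀ t : L, D ≤ (pair.flip t).ker := fun t d hd ↦ by
    rw [AddMonoidHom.mem_ker, AddMonoidHom.flip_apply]
    exact hDL d hd t
  let χ : L → (L ⧸ D →+ AddCircle (1 : ℚ)) := fun t ↦ QuotientAddGroup.lift D (pair.flip t) (hkt t)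
  have hχ : ∀ (t y : L), χ t (y : L ⧸ D) = pair y t := fun t y ↦ by
    show QuotientAddGroup.lift D (pair.flip t) (hkt t) (y : L ⧸ D) = pair y t
    rw [QuotientAddGroup.lift_mk, AddMonoidHom.flip_apply]
  let Φ : L ⧸ D → (L ⧸ D →+ AddCircle (1 : ℚ)) := fun q ↦ χ q.out
  -- `Φ` is injective: the right kernel is `D`
  have hΦ : Function.Injective Φ := by
    intro q₁ q₂ h
    have h' : ∀ y : L, pair y q₁.out = pair y q₂.out := fun y ↦ by
      rw [← hχ, ← hχ]
      exact congrArg (fun φ : L ⧸ D →+ AddCircle (1 : ℚ) ↦ φ (y : L ⧸ D)) h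
    have hmem : -q₁.out + q₂.out ∈ D := hker _ fun y ↦ by
      rw [map_add, map_neg, h', neg_add_cancel]
    rw [← QuotientAddGroup.out_eq' q₁, ← QuotientAddGroup.out_eq' q₂]
    exact QuotientAddGroup.eq.mpr hmem
  -- finite sets of the same cardinality: `Φ` is onto
  haveI : Finite (L ⧸ D →+ AddCircle (1 : ℚ)) := PontryaginCard.finite_characterModule_of_finite (L ⧸ D)
  have hcard : Nat.card (L ⧸ D →+ AddCircle (1 : ℚ)) ≤ Nat.card (L ⧸ D) :=
    (PontryaginCard.natCard_characterModule_of_finite (L ⧸ D)).le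
  have hΦs : Function.Surjective Φ := (hΦ.bijective_of_nat_card_le hcard).2
  -- the character `g` of `L ⧸ D`
  have hgk : D ≤ g.ker := fun d hd ↦ by rw [AddMonoidHom.mem_ker]; exact hg d hd
  obtain ⟨q, hq⟩ := hΦs (QuotientAddGroup.lift D g hgk)
  refine ⟨q.out, fun y ↦ ?_⟩
  rw [← hχ, ← QuotientAddGroup.lift_mk (N := D) hgk y]
  exact (congrArg (fun φ : L ⧸ D →+ AddCircle (1 : ℚ) ↦ φ (y : L ⧸ D)) hq).symm

/-! ## §2 The criterion with finite quotients and non-degenerate pairings -/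

section Dual

variable (p : ℕ) [Fact p.Prime] {S : Type*} [AddCommGroup S] (γ : AddMonoid.End S)
  {L : ℕ → Type*} [∀ n, AddCommGroup (L n)]
  (r : ∀ n, L n →+ S) (ι : ∀ n, L n →+ L (n + 1)) (γL : ∀ n, L n →+ L n)
  (D : ∀ n, AddSubgroup (L n)) (pair : ∀ n, L n →+ L n →+ AddCircle (1 : ℚ))
  {X : Type*} [AddCommGroup X] [Module (IwasawaAlgebra p) X]
  (toDual : X →+ (S →+ AddCircle (1 : ℚ)))

/-- **The Hachimori–Matsuno criterion, dual side, print-shaped pairing hypotheses**: as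
`forall_finite_eq_bot_of_selfDualLayers`, with "every character of `L_n/D_n` is represented" replaced
by: `L_n/D_n` is FINITE (cofinite generation of the layer Selmer group, `D_n` its maximal divisible
subgroup) and `D_n` lies in the left kernel of `⟨·,·⟩_n` (with the right kernel exactly `D_n`, as
before) — i.e. a non-degenerate pairing on the finite `C_n = L_n/D_n` (Cassels–Tate on
`Ш(E/K_n)[p^∞]/div`). Conclusion: `X` has no non-zero finite `Λ`-submodule.
[cite: HachimoriMatsuno2000, Theorem and Corollary (i) (p. 2540)] [cite: Washington1997, Prop. 13.28] -/
theorem forall_finite_eq_bot_of_selfDualLayers_of_finite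
    (hr : ∀ n, Function.Injective (r n))
    (hι : ∀ n (x : L n), r (n + 1) (ι n x) = r n x)
    (hex : ∀ s : S, ∃ n, ∃ x : L n, r n x = s)
    (hγL : ∀ n (x : L n), r n (γL n x) = γ (r n x)) (hγLs : ∀ n, Function.Surjective (γL n))
    (hcores : ∀ n (t : L (n + 1)), ∃ t' : L n,
      r n t' = ∑ i ∈ Finset.range p, (γ ^ (p ^ n * i)) (r (n + 1) t) ∧
        ∀ y : L n, pair n y t' = pair (n + 1) (ι n y) t)
    (hDdiv : ∀ n, ∀ d ∈ D n, ∃ d' ∈ D n, p • d' = d)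
    (hDγ : ∀ n, ∀ d ∈ D n, γL n d ∈ D n)
    (m : ℕ) (hDst : ∀ n, m ≤ n → (D (n + 1)).map (r (n + 1)) ≤ (D n).map (r n))
    (hfin : ∀ n, Finite (L n ⧸ D n))
    (hker : ∀ n (t : L n), (∀ y : L n, pair n y t = 0) → t ∈ D n)
    (hD0 : ∀ n, ∀ t ∈ D n, ∀ y : L n, pair n y t = 0)
    (hD0' : ∀ n, ∀ d ∈ D n, ∀ t : L n, pair n d t = 0)
    (hinv : ∀ n (y t : L n), pair n (γL n y) (γL n t) = pair n y t)
    (hinj : Function.Injective toDual)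
    (hT : ∀ (x : X) (s : S),
      toDual ((PowerSeries.X : IwasawaAlgebra p) • x) s = toDual x (γ s) - toDual x s) :
    ∀ M : Submodule (IwasawaAlgebra p) X, Finite M → M = ⊥ :=
  forall_finite_eq_bot_of_selfDualLayers p γ r ι γL D pair toDual hr hι hex hγL hγLs hcores hDdiv hDγ m
    hDst hker hD0
    (fun n g hg ↦ by
      haveI := hfin n
      exact exists_eq_pair_of_finite_quotient (D n) (pair n) (hker n) (hD0' n) g hg)
    hinv hinj hT

end Dual

end Summit.BirchSwinnertonDyer.Rank1Residual.Iwasawa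

end
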